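import Literature.AnabelianGeometry.EtaleTheta.Discharge.Sec2RigidityNodesReclosedModelTate
import Literature.AnabelianGeometry.EtaleTheta.Discharge.Sec2TowerRowsAtModelTateOfExtendsHgal
import Literature.AnabelianGeometry.EtaleTheta.Discharge.Sec2Cor219iAtModelTateOfExtends
import HarnessLib

/-!
# [EtTh] Cor. 2.19 (i) (cyclotomic rigidity, both splittings) AT THE TATE DATUM OF RECORD with the Cor. 2.18 (i)
# binder `h218i` REPLACED by abc-iut-L6-d6's reduction `⟸ {hextΔ, hgal}` — the K4 RE-CLOSE sibling of cone node
# EtTh:Cor2.19(i) (C-R33 / K4 row 22; R788 menu item M3; proof-only)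

S. Mochizuki, *The Étale Theta Function and its Frobenioid-theoretic Manifestations* [EtTh], Publ. RIMS **45**
(2009), §2: Cor. 2.19 (i) p. 64, Cor. 2.18 (i) p. 60, Cor. 2.18 (ii) p. 60, Prop. 2.14 (i) p. 49, Prop. 2.4 p. 38
(locators `p.N` = PDF pages of the PRIMS text; bib key `MochizukiEtTh2009`).  Cell `abc-iut`, seat abc-iut-L1-t6
(gen 5; row «M3b» = «K4 COR219(i) AT THE TATE DATUM OF RECORD ⟸ {hextΔ, hgal}», abc-iut-L2-lead gen 6 R834 — the
pair of abc-iut-w6-d050's row M3).  PROOF-ONLY: no definition, no instance, no notation,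
no new named fact; nothing of another seat is edited or restated — every input is consumed BY NAME.

STATE OF RECORD BEFORE THIS FILE.  abc-iut-c312-2's `CONE-K4-RECLOSE.tsv` v4 lists node EtTh:Cor2.19(i) (closer
`RigidData.iso_inMu_eq_coeffAut_of_cor219`, refuted-closure binder F-0626 `h219 : R.Cor219_i_splittings`) as
RECLOSABLE with no evidence.  abc-iut-L2-t2 (gen 7, `Discharge/Sec2RigidityNodesReclosedModelTate`, p465271 §3)
re-derived F-0626 at the Tate datum of record — Tate instance `ThetaSetting.modelχq p 1 2`, étale-theta datum
`SettingModel.etaleThetaDataχqInr p` (abc-iut-w5-d171; Prop. 1.5 (iii) is the THEOREM `prop15iii_etaleThetaDataχqInr`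
there), every `X̲̲`-choice `C`, level `μ`, cusp labelling `L` — MODULO the one residual `h218i` = F-0620 Cor. 2.18 (i)
for the same rigidity data (`cor219_i_splittings_modelTate_inr_of_cor218_i`; verdict INSTANCE-CONDITIONAL).
abc-iut-L6-d6 (gen 5, `Discharge/Sec2Cor218iAtModelTateOfExtends`, p468072) then proved Cor. 2.18 (i) for
`C.rigidData μ hC hS h15 L∅` at `modelχq p i 2` — EVERY `i`, étale-theta datum, `X̲̲`-choice, level; the EMPTY cusp
labelling `L∅ := ⟨fun _ => ∅, fun _ => ∅, _⟩` — FROM the two label-free, FACT-free hypotheses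
  `hextΔ` : every bi-continuous automorphism `γ` of `Π^tp_X̲̲` extends to a bi-continuous automorphism `Γ` of
            `Π^tp_X` with `Γ(Δ^tp_X) = Δ^tp_X` ([EtTh] Prop. 2.4 (i) / [AbsAnab] Lem. 1.3.8 shape), and
  `hgal`  : every such `γ` lies over an INNER automorphism of `G_{ℚ_p}` ([AbsTopIII] Cor. 1.10 shape)
(`SettingModel.rigidData_cor218_i_modelχq_of_extends_of_hgal`), and abc-iut-f-153 (gen 6,
`Discharge/Sec2TowerRowsAtModelTateOfExtendsHgal`, p469677) recorded its chain-level / all-level forms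
`cor218_i_levels_emptyLabels_modelTate_inr_of_extends_of_hgal` / `cor218_i_modAll_emptyLabels_…`.  THE PAIR FILE
(landed first, cited BY NAME, nothing restated): abc-iut-w6-d050 (gen 5, `Discharge/Sec2Cor219iAtModelTateOfExtends`, p478893,
row M3) derives the same node at `modelχq p i 2` from `hextΔ` ALONE when `p ≡ 1 (mod 4)` or `i` is even (abc-iut-L6-d6's
`Sec2Cor218iAtModelTateNonInnerModFour`, p477049), in particular `cor219_i_splittings_modelTate_inr_of_extends_of_mod_four_eq_one`
at the datum of record; the present file covers EVERY prime `p` at the price of the second binder `hgal`.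

WHAT THIS FILE DOES (one-term compositions at `i := 1`, `L := L∅`; binders left = data `C`, `μ` / `τ`, `M` and the
two Props `hextΔ`, `hgal` — 0 FACT-LIST rows):
* `cor219_i_splittings_emptyLabels_modelTate_inr_of_extends_of_hgal` — F-0626 [EtTh] Cor. 2.19 (i), both
  splittings, for the rigidity data of the datum of record at every single level `μ` ⟸ {hextΔ, hgal};
* `cor219_i_splittings_levels_emptyLabels_…` / `cor219_i_splittings_modAll_emptyLabels_…` — the same at every
  chain level `τ.mod M` and every level `τ.modAll M` of a cyclotome tower `τ` of the Tate instance;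
* `cor219_i_splittings_emptyLabels_modelTate_inr_of_extends` — the JOINT reduction of record with the pair file:
  F-0626 at the datum of record ⟸ hextΔ ∧ (`p ≡ 1 (mod 4)` ∨ hgal) (case split on abc-iut-w6-d050's theorem / §1);
* `iso_inMu_eq_coeffAut_emptyLabels_modelTate_inr_of_extends_of_hgal` — the cone CLOSER of the node,
  `RigidData.iso_inMu_eq_coeffAut_of_cor219` ("every automorphism `α` of `M_η` over `γ` acts on `μ_N` through the
  coefficient automorphism `γ̄_μ`"), with its head binder `h219` (F-0626) RE-KEYED onto {hextΔ, hgal};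
* `sec2_rigidity_nodes_emptyLabels_modelTate_inr_of_extends_of_hgal` — census conjunction: at the datum of
  record and the empty labelling, Prop. 2.14 (i) ∧ Cor. 2.18 (ii) outright (abc-iut-L2-t2) and Cor. 2.18 (i) ∧
  Cor. 2.19 (i) ⟸ {hextΔ, hgal} — the four §2 rigidity nodes of K4 rows 19/20/22/38 with NO FACT binder;
* `exists_rigidData_cor219_i_splittings_modelTate_of_extends_of_hgal` — NON-VACUITY of the carrier: for every
  odd `l` and level `N` the data `E`, `C`, `μ` of the statements EXIST over `modelχq p 1 2` with `η̈♯ = etaDdχq`,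
  `Π^tp_X̲̲ = Huuχq` (so the theorems above do not quantify over an empty family), and at those witnesses
  Cor. 2.18 (i) ∧ Cor. 2.19 (i) follow from {hextΔ, hgal}.

K4 VERDICT PROPOSED (evidence `K4-L1t6-COR219i-RECLOSED.tsv` → abc-iut-c312-2): row 22 EtTh:Cor2.19(i), F-0626 —
RECLOSED by this file, CONDITIONAL-AT-MODEL ⟸ {hextΔ, hgal} (was INSTANCE-CONDITIONAL ⟸ {F-0620@datum}); the closer
re-keyed likewise.  RESIDUAL-OF-RECORD: {hextΔ, hgal} — statements about the bi-continuous automorphism group of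
`Π^tp_X̲̲ ≤ dUU_l ⋊ G_{ℚ_p}` which no tree / Mathlib fact decides (abc-iut-L6-d6 gen 5 verdict «F-0620@modelTate
UNDECIDED as a ∀, REDUCED IN KERNEL to {hextΔ, hgal}», memo HOME/staging/L6/L6-d6/g5/COR218I-AT-MODELTATE.md).

HONEST LABEL: `modelχq` is a SEMI-SYNTHETIC model of the typed §1 interface (the Tate-sheared χ-twisted root datum;
NOT the tempered fundamental group of a curve) — binder-discharge / non-vacuity evidence for OUR typed rows only; the
universal closures of F-0620 / F-0626 stay REFUTED-AS-TYPED over the lawless interface (abc-iut-w5-d175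
`RigidData.Toy.not_forall_*`) — refuted-as-typed ≠ refuted-in-print; `hextΔ` / `hgal` are DISPLAYED as binders and NOT
asserted; nothing of [EtTh] (refereed) is asserted beyond the displayed statements; a FACT row is an assumption label,
not an endorsement; no side is taken on [IUTchIII] Cor. 3.12; typed ≠ proved; re-closed ≠ endorsed.
-/

noncomputable section

namespace Literature.AnabelianGeometry.EtaleTheta.SettingModel

open Literature.AnabelianGeometry.SemiGraphs

variable (p : ℕ) [Fact p.Prime]
variable {l : ℕ} (C : (etaleThetaDataχqInr p).DoubleUnderline l) {N : ℕ+}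
  (μ : (ThetaSetting.modelχq p 1 2 even_two).CyclotomeMod l N) {Es : Set ℕ+}
  (τ : (ThetaSetting.modelχq p 1 2 even_two).CyclotomeTower l Es)

/-! ## §1. Node EtTh:Cor2.19(i) (K4 row 22): F-0626 at the datum of record ⟸ {hextΔ, hgal} -/

/-- **F-0626 [EtTh] Cor. 2.19 (i), both splittings, for the rigidity data of the datum OF RECORD at the empty cusp
labelling, FROM `hextΔ` and `hgal`** (p. 64: every automorphism of the model mono-theta environment `M_η` preserves
`s^alg(l·Δ_Θ)` and `s^Θ_η(l·Δ_Θ)`): abc-iut-L2-t2's `cor219_i_splittings_modelTate_inr_of_cor218_i` (temp-slimness,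
Prop. 2.14 (i) and Prop. 1.5 (iii) are THEOREMS at the record) with its ONE residual `h218i` — F-0620 Cor. 2.18 (i) AT
THE DATUM — SUPPLIED by abc-iut-L6-d6's `rigidData_cor218_i_modelχq_of_extends_of_hgal` at `i := 1`.  Binders left:
data `C`, `μ` and the two label-free Props `hextΔ` ([EtTh] Prop. 2.4 (i) shape), `hgal` ([AbsTopIII] Cor. 1.10 shape);
0 FACT-LIST rows. [cite: MochizukiEtTh2009, Cor 2.19 (i) p.64] -/
theorem cor219_i_splittings_emptyLabels_modelTate_inr_of_extends_of_hgal
    (hext : ∀ γ : ↥C.Huu ≃ₜ* ↥C.Huu, ∃ Γ : PiTpχq p 1 2 ≃ₜ* PiTpχq p 1 2,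
      (∀ h : C.Huu, Γ (h : PiTpχq p 1 2) = ((γ h : C.Huu) : PiTpχq p 1 2)) ∧
        (curveχq p 1 2).DeltaTemp.map Γ.toMulEquiv.toMonoidHom = (curveχq p 1 2).DeltaTemp)
    (hgal : ∀ γ : ↥C.Huu ≃ₜ* ↥C.Huu, ∃ t : GQp p, ∀ h : C.Huu,
      (((γ h : C.Huu) : PiTpχq p 1 2)).right = t * (h : PiTpχq p 1 2).right * t⁻¹) :
    Literature.AnabelianGeometry.EtaleTheta.RigidData.Cor219_i_splittings
      (C.rigidData μ (compat_modelχq p 1 2 even_two) (ThetaSetting.modelχq_sec2Hyps p 1 2 even_two)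
        (prop15iii_etaleThetaDataχqInr p _) ⟨fun _ => ∅, fun _ => ∅, fun _ => rfl⟩) :=
  cor219_i_splittings_modelTate_inr_of_cor218_i p C μ _
    (rigidData_cor218_i_modelχq_of_extends_of_hgal p 1 C μ _ _ _ hext hgal)

/-- **F-0626 at EVERY CHAIN LEVEL `τ.mod M` (`M ∈ E`) of a cyclotome tower of the Tate instance, empty cusp
labelling, ⟸ {hextΔ, hgal}** — the `h218i` slot is abc-iut-f-153's chain-level form
`cor218_i_levels_emptyLabels_modelTate_inr_of_extends_of_hgal` of abc-iut-L6-d6's theorem.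
[cite: MochizukiEtTh2009, Cor 2.19 (i) p.64] -/
theorem cor219_i_splittings_levels_emptyLabels_modelTate_inr_of_extends_of_hgal
    (hext : ∀ γ : ↥C.Huu ≃ₜ* ↥C.Huu, ∃ Γ : PiTpχq p 1 2 ≃ₜ* PiTpχq p 1 2,
      (∀ h : C.Huu, Γ (h : PiTpχq p 1 2) = ((γ h : C.Huu) : PiTpχq p 1 2)) ∧
        (curveχq p 1 2).DeltaTemp.map Γ.toMulEquiv.toMonoidHom = (curveχq p 1 2).DeltaTemp)
    (hgal : ∀ γ : ↥C.Huu ≃ₜ* ↥C.Huu, ∃ t : GQp p, ∀ h : C.Huu,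
      (((γ h : C.Huu) : PiTpχq p 1 2)).right = t * (h : PiTpχq p 1 2).right * t⁻¹)
    (M : Es) :
    Literature.AnabelianGeometry.EtaleTheta.RigidData.Cor219_i_splittings
      (C.rigidData (τ.mod M) (compat_modelχq p 1 2 even_two) (ThetaSetting.modelχq_sec2Hyps p 1 2 even_two)
        (prop15iii_etaleThetaDataχqInr p _) ⟨fun _ => ∅, fun _ => ∅, fun _ => rfl⟩) :=
  cor219_i_splittings_modelTate_inr_of_cor218_i p C (τ.mod M) _
    (cor218_i_levels_emptyLabels_modelTate_inr_of_extends_of_hgal p C τ hext hgal M)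

/-- **F-0626 at EVERY LEVEL `τ.modAll M` (`M ∈ ℕ≥1`) of a cyclotome tower of the Tate instance, empty cusp labelling,
⟸ {hextΔ, hgal}** (the level data of the `modAll` surjectivity rows / the [IUTchII] Prop. 1.5 bridges).
[cite: MochizukiEtTh2009, Cor 2.19 (i) p.64] -/
theorem cor219_i_splittings_modAll_emptyLabels_modelTate_inr_of_extends_of_hgal
    (hext : ∀ γ : ↥C.Huu ≃ₜ* ↥C.Huu, ∃ Γ : PiTpχq p 1 2 ≃ₜ* PiTpχq p 1 2,
      (∀ h : C.Huu, Γ (h : PiTpχq p 1 2) = ((γ h : C.Huu) : PiTpχq p 1 2)) ∧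
        (curveχq p 1 2).DeltaTemp.map Γ.toMulEquiv.toMonoidHom = (curveχq p 1 2).DeltaTemp)
    (hgal : ∀ γ : ↥C.Huu ≃ₜ* ↥C.Huu, ∃ t : GQp p, ∀ h : C.Huu,
      (((γ h : C.Huu) : PiTpχq p 1 2)).right = t * (h : PiTpχq p 1 2).right * t⁻¹)
    (M : ℕ+) :
    Literature.AnabelianGeometry.EtaleTheta.RigidData.Cor219_i_splittings
      (C.rigidData (τ.modAll M) (compat_modelχq p 1 2 even_two) (ThetaSetting.modelχq_sec2Hyps p 1 2 even_two)
        (prop15iii_etaleThetaDataχqInr p _) ⟨fun _ => ∅, fun _ => ∅, fun _ => rfl⟩) :=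
  cor219_i_splittings_modelTate_inr_of_cor218_i p C (τ.modAll M) _
    (cor218_i_modAll_emptyLabels_modelTate_inr_of_extends_of_hgal p C τ hext hgal M)

/-- **JOINT REDUCTION OF RECORD for K4 row 22 at the Tate datum (this file's {hextΔ, hgal} route ∪ the pair file's
`p ≡ 1 (mod 4)` route)**: F-0626 [EtTh] Cor. 2.19 (i), both splittings, for the rigidity data of the datum of record at
the empty cusp labelling, FROM `hextΔ` and the DISJUNCTION «`p ≡ 1 (mod 4)` ∨ `hgal`» — the first disjunct by
abc-iut-w6-d050's `cor219_i_splittings_modelTate_inr_of_extends_of_mod_four_eq_one` (p478893; `hgal` idle there), the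
second by §1.  0 FACT-LIST rows. [cite: MochizukiEtTh2009, Cor 2.19 (i) p.64] -/
theorem cor219_i_splittings_emptyLabels_modelTate_inr_of_extends
    (hext : ∀ γ : ↥C.Huu ≃ₜ* ↥C.Huu, ∃ Γ : PiTpχq p 1 2 ≃ₜ* PiTpχq p 1 2,
      (∀ h : C.Huu, Γ (h : PiTpχq p 1 2) = ((γ h : C.Huu) : PiTpχq p 1 2)) ∧
        (curveχq p 1 2).DeltaTemp.map Γ.toMulEquiv.toMonoidHom = (curveχq p 1 2).DeltaTemp)
    (h : p % 4 = 1 ∨ ∀ γ : ↥C.Huu ≃ₜ* ↥C.Huu, ∃ t : GQp p, ∀ h : C.Huu,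
      (((γ h : C.Huu) : PiTpχq p 1 2)).right = t * (h : PiTpχq p 1 2).right * t⁻¹) :
    Literature.AnabelianGeometry.EtaleTheta.RigidData.Cor219_i_splittings
      (C.rigidData μ (compat_modelχq p 1 2 even_two) (ThetaSetting.modelχq_sec2Hyps p 1 2 even_two)
        (prop15iii_etaleThetaDataχqInr p _) ⟨fun _ => ∅, fun _ => ∅, fun _ => rfl⟩) :=
  h.elim (fun hp => cor219_i_splittings_modelTate_inr_of_extends_of_mod_four_eq_one p C μ hp hext)
    (fun hgal => cor219_i_splittings_emptyLabels_modelTate_inr_of_extends_of_hgal p C μ hext hgal)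

/-! ## §2. The cone CLOSER of the node, re-keyed from F-0626 onto {hextΔ, hgal} -/

/-- **The cone closer `RigidData.iso_inMu_eq_coeffAut_of_cor219` RE-KEYED at the datum of record onto {hextΔ, hgal}
(C-R33 / K4 row 22)**: for `R` the rigidity data of the datum of record at the empty cusp labelling, every
automorphism `α` of the model mono-theta environment `M_η` lying over `γ ∈ Aut(Π^tp_X̲̲)` acts on `μ_N` through the
coefficient automorphism `γ̄_μ` of `γ` — `α(ι(a)) = ι(γ̄_μ(a))` (p. 64) — its head binder `h219` (F-0626) being §1's
theorem (abc-iut-L2-t2's `iso_inMu_eq_coeffAut_modelTate_inr_of_cor218_i` with `h218i :=` abc-iut-L6-d6's theorem).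
Binders left: data, the structural hypotheses `hη`, `hαγ`, `hγμ` of the closer itself, and the Props `hextΔ`, `hgal`.
[cite: MochizukiEtTh2009, Cor 2.19 (i) p.64] -/
theorem iso_inMu_eq_coeffAut_emptyLabels_modelTate_inr_of_extends_of_hgal
    (hext : ∀ γ : ↥C.Huu ≃ₜ* ↥C.Huu, ∃ Γ : PiTpχq p 1 2 ≃ₜ* PiTpχq p 1 2,
      (∀ h : C.Huu, Γ (h : PiTpχq p 1 2) = ((γ h : C.Huu) : PiTpχq p 1 2)) ∧
        (curveχq p 1 2).DeltaTemp.map Γ.toMulEquiv.toMonoidHom = (curveχq p 1 2).DeltaTemp)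
    (hgal : ∀ γ : ↥C.Huu ≃ₜ* ↥C.Huu, ∃ t : GQp p, ∀ h : C.Huu,
      (((γ h : C.Huu) : PiTpχq p 1 2)).right = t * (h : PiTpχq p 1 2).right * t⁻¹)
    {η : (C.rigidData μ (compat_modelχq p 1 2 even_two) (ThetaSetting.modelχq_sec2Hyps p 1 2 even_two)
        (prop15iii_etaleThetaDataχqInr p _) ⟨fun _ => ∅, fun _ => ∅, fun _ => rfl⟩).PiYdd →
      (C.rigidData μ (compat_modelχq p 1 2 even_two) (ThetaSetting.modelχq_sec2Hyps p 1 2 even_two)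
        (prop15iii_etaleThetaDataχqInr p _) ⟨fun _ => ∅, fun _ => ∅, fun _ => rfl⟩).mu}
    (hη : η ∈ (C.rigidData μ (compat_modelχq p 1 2 even_two) (ThetaSetting.modelχq_sec2Hyps p 1 2 even_two)
      (prop15iii_etaleThetaDataχqInr p _) ⟨fun _ => ∅, fun _ => ∅, fun _ => rfl⟩).thetaCocycles)
    (α : ((C.rigidData μ (compat_modelχq p 1 2 even_two) (ThetaSetting.modelχq_sec2Hyps p 1 2 even_two)
          (prop15iii_etaleThetaDataχqInr p _) ⟨fun _ => ∅, fun _ => ∅, fun _ => rfl⟩).modelMono hη).Iso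
      ((C.rigidData μ (compat_modelχq p 1 2 even_two) (ThetaSetting.modelχq_sec2Hyps p 1 2 even_two)
          (prop15iii_etaleThetaDataχqInr p _) ⟨fun _ => ∅, fun _ => ∅, fun _ => rfl⟩).modelMono hη))
    (γ : (C.rigidData μ (compat_modelχq p 1 2 even_two) (ThetaSetting.modelχq_sec2Hyps p 1 2 even_two)
          (prop15iii_etaleThetaDataχqInr p _) ⟨fun _ => ∅, fun _ => ∅, fun _ => rfl⟩).PiX ≃*
      (C.rigidData μ (compat_modelχq p 1 2 even_two) (ThetaSetting.modelχq_sec2Hyps p 1 2 even_two)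
          (prop15iii_etaleThetaDataχqInr p _) ⟨fun _ => ∅, fun _ => ∅, fun _ => rfl⟩).PiX)
    (hαγ : ∀ x : (C.rigidData μ (compat_modelχq p 1 2 even_two) (ThetaSetting.modelχq_sec2Hyps p 1 2 even_two)
          (prop15iii_etaleThetaDataχqInr p _) ⟨fun _ => ∅, fun _ => ∅, fun _ => rfl⟩).env,
      ((CycEnvelope.proj
          (C.rigidData μ (compat_modelχq p 1 2 even_two) (ThetaSetting.modelχq_sec2Hyps p 1 2 even_two)
            (prop15iii_etaleThetaDataχqInr p _) ⟨fun _ => ∅, fun _ => ∅, fun _ => rfl⟩).augY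
          (C.rigidData μ (compat_modelχq p 1 2 even_two) (ThetaSetting.modelχq_sec2Hyps p 1 2 even_two)
            (prop15iii_etaleThetaDataχqInr p _) ⟨fun _ => ∅, fun _ => ∅, fun _ => rfl⟩).chi (α.e x) :
          (C.rigidData μ (compat_modelχq p 1 2 even_two) (ThetaSetting.modelχq_sec2Hyps p 1 2 even_two)
            (prop15iii_etaleThetaDataχqInr p _) ⟨fun _ => ∅, fun _ => ∅, fun _ => rfl⟩).PiY) :
          (C.rigidData μ (compat_modelχq p 1 2 even_two) (ThetaSetting.modelχq_sec2Hyps p 1 2 even_two)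
            (prop15iii_etaleThetaDataχqInr p _) ⟨fun _ => ∅, fun _ => ∅, fun _ => rfl⟩).PiX) =
        γ ((CycEnvelope.proj
          (C.rigidData μ (compat_modelχq p 1 2 even_two) (ThetaSetting.modelχq_sec2Hyps p 1 2 even_two)
            (prop15iii_etaleThetaDataχqInr p _) ⟨fun _ => ∅, fun _ => ∅, fun _ => rfl⟩).augY
          (C.rigidData μ (compat_modelχq p 1 2 even_two) (ThetaSetting.modelχq_sec2Hyps p 1 2 even_two)
            (prop15iii_etaleThetaDataχqInr p _) ⟨fun _ => ∅, fun _ => ∅, fun _ => rfl⟩).chi x :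
          (C.rigidData μ (compat_modelχq p 1 2 even_two) (ThetaSetting.modelχq_sec2Hyps p 1 2 even_two)
            (prop15iii_etaleThetaDataχqInr p _) ⟨fun _ => ∅, fun _ => ∅, fun _ => rfl⟩).PiY) :
          (C.rigidData μ (compat_modelχq p 1 2 even_two) (ThetaSetting.modelχq_sec2Hyps p 1 2 even_two)
            (prop15iii_etaleThetaDataχqInr p _) ⟨fun _ => ∅, fun _ => ∅, fun _ => rfl⟩).PiX))
    (γμ : (C.rigidData μ (compat_modelχq p 1 2 even_two) (ThetaSetting.modelχq_sec2Hyps p 1 2 even_two)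
          (prop15iii_etaleThetaDataχqInr p _) ⟨fun _ => ∅, fun _ => ∅, fun _ => rfl⟩).mu ≃*
      (C.rigidData μ (compat_modelχq p 1 2 even_two) (ThetaSetting.modelχq_sec2Hyps p 1 2 even_two)
          (prop15iii_etaleThetaDataχqInr p _) ⟨fun _ => ∅, fun _ => ∅, fun _ => rfl⟩).mu)
    (hγμ : ∀ (g : (C.rigidData μ (compat_modelχq p 1 2 even_two) (ThetaSetting.modelχq_sec2Hyps p 1 2 even_two)
          (prop15iii_etaleThetaDataχqInr p _) ⟨fun _ => ∅, fun _ => ∅, fun _ => rfl⟩).lDeltaTheta)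
        (hg' : γ g ∈ (C.rigidData μ (compat_modelχq p 1 2 even_two) (ThetaSetting.modelχq_sec2Hyps p 1 2 even_two)
          (prop15iii_etaleThetaDataχqInr p _) ⟨fun _ => ∅, fun _ => ∅, fun _ => rfl⟩).lDeltaTheta),
      (C.rigidData μ (compat_modelχq p 1 2 even_two) (ThetaSetting.modelχq_sec2Hyps p 1 2 even_two)
          (prop15iii_etaleThetaDataχqInr p _) ⟨fun _ => ∅, fun _ => ∅, fun _ => rfl⟩).thetaMod ⟨γ g, hg'⟩ =
        γμ ((C.rigidData μ (compat_modelχq p 1 2 even_two) (ThetaSetting.modelχq_sec2Hyps p 1 2 even_two)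
          (prop15iii_etaleThetaDataχqInr p _) ⟨fun _ => ∅, fun _ => ∅, fun _ => rfl⟩).thetaMod g))
    (a : (C.rigidData μ (compat_modelχq p 1 2 even_two) (ThetaSetting.modelχq_sec2Hyps p 1 2 even_two)
          (prop15iii_etaleThetaDataχqInr p _) ⟨fun _ => ∅, fun _ => ∅, fun _ => rfl⟩).mu) :
    α.e (CycEnvelope.inMu
        (C.rigidData μ (compat_modelχq p 1 2 even_two) (ThetaSetting.modelχq_sec2Hyps p 1 2 even_two)
          (prop15iii_etaleThetaDataχqInr p _) ⟨fun _ => ∅, fun _ => ∅, fun _ => rfl⟩).augY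
        (C.rigidData μ (compat_modelχq p 1 2 even_two) (ThetaSetting.modelχq_sec2Hyps p 1 2 even_two)
          (prop15iii_etaleThetaDataχqInr p _) ⟨fun _ => ∅, fun _ => ∅, fun _ => rfl⟩).chi a) =
      CycEnvelope.inMu
        (C.rigidData μ (compat_modelχq p 1 2 even_two) (ThetaSetting.modelχq_sec2Hyps p 1 2 even_two)
          (prop15iii_etaleThetaDataχqInr p _) ⟨fun _ => ∅, fun _ => ∅, fun _ => rfl⟩).augY
        (C.rigidData μ (compat_modelχq p 1 2 even_two) (ThetaSetting.modelχq_sec2Hyps p 1 2 even_two)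
          (prop15iii_etaleThetaDataχqInr p _) ⟨fun _ => ∅, fun _ => ∅, fun _ => rfl⟩).chi (γμ a) :=
  iso_inMu_eq_coeffAut_modelTate_inr_of_cor218_i p C μ _
    (rigidData_cor218_i_modelχq_of_extends_of_hgal p 1 C μ _ _ _ hext hgal) hη α γ hαγ γμ hγμ a

/-! ## §3. Census conjunction and non-vacuity -/

/-- **THE FOUR §2 RIGIDITY NODES (K4 rows 38 / 20 / 19 / 22) AT THE DATUM OF RECORD AND THE EMPTY CUSP LABELLING,
WITH NO FACT BINDER**: Prop. 2.14 (i) (F-0631) ∧ Cor. 2.18 (ii) (F-0621) HOLD outright (abc-iut-L2-t2's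
`prop214_i_modelTate_inr`, abc-iut-f-153's `cor218_ii_modelTate_inr`), and Cor. 2.18 (i) (F-0620) ∧ Cor. 2.19 (i)
(F-0626, both splittings) HOLD given {hextΔ, hgal} — every `X̲̲`-choice `C`, every level `μ`.
[cite: MochizukiEtTh2009, Cor 2.19 (i) p.64] -/
theorem sec2_rigidity_nodes_emptyLabels_modelTate_inr_of_extends_of_hgal
    (hext : ∀ γ : ↥C.Huu ≃ₜ* ↥C.Huu, ∃ Γ : PiTpχq p 1 2 ≃ₜ* PiTpχq p 1 2,
      (∀ h : C.Huu, Γ (h : PiTpχq p 1 2) = ((γ h : C.Huu) : PiTpχq p 1 2)) ∧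
        (curveχq p 1 2).DeltaTemp.map Γ.toMulEquiv.toMonoidHom = (curveχq p 1 2).DeltaTemp)
    (hgal : ∀ γ : ↥C.Huu ≃ₜ* ↥C.Huu, ∃ t : GQp p, ∀ h : C.Huu,
      (((γ h : C.Huu) : PiTpχq p 1 2)).right = t * (h : PiTpχq p 1 2).right * t⁻¹) :
    Literature.AnabelianGeometry.EtaleTheta.RigidData.Prop214_i
        (C.rigidData μ (compat_modelχq p 1 2 even_two) (ThetaSetting.modelχq_sec2Hyps p 1 2 even_two)
          (prop15iii_etaleThetaDataχqInr p _) ⟨fun _ => ∅, fun _ => ∅, fun _ => rfl⟩) ∧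
      Literature.AnabelianGeometry.EtaleTheta.RigidData.Cor218_ii
        (C.rigidData μ (compat_modelχq p 1 2 even_two) (ThetaSetting.modelχq_sec2Hyps p 1 2 even_two)
          (prop15iii_etaleThetaDataχqInr p _) ⟨fun _ => ∅, fun _ => ∅, fun _ => rfl⟩) ∧
      (C.rigidData μ (compat_modelχq p 1 2 even_two) (ThetaSetting.modelχq_sec2Hyps p 1 2 even_two)
          (prop15iii_etaleThetaDataχqInr p _) ⟨fun _ => ∅, fun _ => ∅, fun _ => rfl⟩).Cor218_i ∧
      Literature.AnabelianGeometry.EtaleTheta.RigidData.Cor219_i_splittings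
        (C.rigidData μ (compat_modelχq p 1 2 even_two) (ThetaSetting.modelχq_sec2Hyps p 1 2 even_two)
          (prop15iii_etaleThetaDataχqInr p _) ⟨fun _ => ∅, fun _ => ∅, fun _ => rfl⟩) :=
  ⟨prop214_i_modelTate_inr p C μ _, cor218_ii_modelTate_inr p C μ _,
    rigidData_cor218_i_modelχq_of_extends_of_hgal p 1 C μ _ _ _ hext hgal,
    cor219_i_splittings_emptyLabels_modelTate_inr_of_extends_of_hgal p C μ hext hgal⟩

/-- **NON-VACUITY of the carrier of §1–§3**: for every ODD `l` and every level `N ∈ ℕ≥1` there EXIST, over the Tate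
instance `modelχq p 1 2`, an étale-theta datum `E` of the class of record `η̈♯ = etaDdχq p 1 2`, an `X̲̲`-choice `C`
with `Π^tp_X̲̲ = Huuχq p 1 2 l`, a level-`N` cyclotome identification `μ` and a proof `h15` of Prop. 1.5 (iii) for `E`
(witnesses `etaleThetaDataχqInr`, `doubleUnderlineχqOfEtaRes` + `eta_res_etaDdχq`, `modelχq_nonempty_cyclotomeMod`,
`prop15iii_etaleThetaDataχqInr` — as in abc-iut-L2-t2's `exists_rigidData_prop214_i_and_cor218_ii_modelTate`), at
which Cor. 2.18 (i) AND Cor. 2.19 (i) for `C.rigidData μ … h15 L∅` follow from {hextΔ, hgal} for THAT `C`.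
[cite: MochizukiEtTh2009, Cor 2.19 (i) p.64] -/
theorem exists_rigidData_cor219_i_splittings_modelTate_of_extends_of_hgal (l : ℕ+) (hl : Odd (l : ℕ)) (N : ℕ+) :
    ∃ (E : (ThetaSetting.modelχq p 1 2 even_two).EtaleThetaData) (C : E.DoubleUnderline l)
      (μ : (ThetaSetting.modelχq p 1 2 even_two).CyclotomeMod l N)
      (h15 : ThetaSetting.Prop15iii E (compat_modelχq p 1 2 even_two)),
      E.etaDd = etaDdχq p 1 2 even_two ∧ C.Huu = Huuχq p 1 2 l hl ∧
        ((∀ γ : ↥C.Huu ≃ₜ* ↥C.Huu, ∃ Γ : PiTpχq p 1 2 ≃ₜ* PiTpχq p 1 2,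
            (∀ h : C.Huu, Γ (h : PiTpχq p 1 2) = ((γ h : C.Huu) : PiTpχq p 1 2)) ∧
              (curveχq p 1 2).DeltaTemp.map Γ.toMulEquiv.toMonoidHom = (curveχq p 1 2).DeltaTemp) →
          (∀ γ : ↥C.Huu ≃ₜ* ↥C.Huu, ∃ t : GQp p, ∀ h : C.Huu,
            (((γ h : C.Huu) : PiTpχq p 1 2)).right = t * (h : PiTpχq p 1 2).right * t⁻¹) →
          (C.rigidData μ (compat_modelχq p 1 2 even_two) (ThetaSetting.modelχq_sec2Hyps p 1 2 even_two) h15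
              ⟨fun _ => ∅, fun _ => ∅, fun _ => rfl⟩).Cor218_i ∧
            Literature.AnabelianGeometry.EtaleTheta.RigidData.Cor219_i_splittings
              (C.rigidData μ (compat_modelχq p 1 2 even_two) (ThetaSetting.modelχq_sec2Hyps p 1 2 even_two) h15
                ⟨fun _ => ∅, fun _ => ∅, fun _ => rfl⟩)) := by
  obtain ⟨μ⟩ := modelχq_nonempty_cyclotomeMod p 1 2 even_two l.pos N
  exact ⟨etaleThetaDataχqInr p,
    (etaleThetaDataχqInr p).doubleUnderlineχqOfEtaRes p 1 2 l hl (eta_res_etaDdχq p 1 2 even_two l hl), μ,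
    prop15iii_etaleThetaDataχqInr p _, rfl, rfl, fun hext hgal =>
      ⟨rigidData_cor218_i_modelχq_of_extends_of_hgal p 1 _ μ _ _ _ hext hgal,
        cor219_i_splittings_emptyLabels_modelTate_inr_of_extends_of_hgal p _ μ hext hgal⟩⟩

end Literature.AnabelianGeometry.EtaleTheta.SettingModel

end
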